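import Summits.SmoothPoincare4.SmoothPoincare4.Theses.SymplecticOrigami
import Summits.SmoothPoincare4.SmoothPoincare4.Theorems.OrigamiFoldExistence.Negative.ZeroSlack
import Literature.Geometry.Symplectic.SteinTwoHandles
import Literature.Geometry.Symplectic.SteinFillingSphere

/-!
# Sketch — crux-ideate round 2, ideator 4, crux stmt-SmoothPoincare4-7844 (`OrigamiFoldExistence`)

First lemmas of the two round-2 crux ideas (typed over existing declarations; not proved
unless trivial):

* idea `reeb-shadow-boothby-wang`: `ReebFoldRecognition` (the SW-free, door-free recogniser of
  Reeb-fold positions of a homotopy 4-sphere inside the Boothby–Wang sphere `S⁵ ⊂ ℂ³`),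
  `ReebFoldPositionExists` (the strengthened existence statement E⁺), and the sorry-free
  compositions `smoothPoincare4_of_reebFold`, `origamiFoldExistence_of_reebFold`
  (E⁺ + recogniser ⇒ SPC4 ⇒ E, WITHOUT the cruxes `OrigamiRung` / `NoGenusTwoDoor`).
* idea `bennequin-defect-certificates`: `legendrianCertificate_ball` — a Legendrian
  presentation of defect zero of a compact 4-manifold with boundary `S³` certifies that it is
  the 4-ball (Gompf 1998 Thm 1.3 / Akbulut–Matveyev 1998 §3 + Eliashberg 1990 Thm 5.1), proved
  here from the two named facts; `LegendrianPresentationOfFakeBalls` (the apex of the line,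
  in scope "3-handle-free"), and the composition down to `SmoothPoincare4`-shaped conclusions.
-/

noncomputable section

set_option linter.dupNamespace false

open scoped Manifold ContDiff Topology ContinuousMap
open Set Function

namespace Summit.SmoothPoincare4.SmoothPoincare4.Cruxes.OrigamiFoldExistence.Ideator4

open Summit.SmoothPoincare4.SmoothPoincare4.Theses.SymplecticOrigami
open Summit.SmoothPoincare4.SmoothPoincare4.Theorems.OrigamiFoldExistence
open Literature.Geometry.Symplectic
open Literature.Topology.FourManifolds

/-- Local notation: `ℝ⁶ = ℂ³` (coordinates `x₁ y₁ x₂ y₂ x₃ y₃`). -/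
local notation "E6" => EuclideanSpace ℝ (Fin 6)

/-- Local notation: `ℝ⁴`. -/
local notation "E4" => EuclideanSpace ℝ (Fin 4)

/-- Local notation: the round 4-sphere with Mathlib's smooth structure. -/
local notation "𝕊⁴" => (Metric.sphere (0 : EuclideanSpace ℝ (Fin 5)) 1)

/-- Local notation: the round 3-sphere. -/
local notation "𝕊³" => (Metric.sphere (0 : EuclideanSpace ℝ (Fin 4)) 1)

/-- Local notation: the unit circle. -/
local notation "𝕊¹" => (Metric.sphere (0 : EuclideanSpace ℝ (Fin 2)) 1)

/-- Local notation: the closed unit 4-ball with its manifold-with-boundary structure. -/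
local notation "𝔻⁴" => (Metric.closedBall (0 : EuclideanSpace ℝ (Fin 4)) 1)

/-! ## Idea A — `reeb-shadow-boothby-wang` -/

/-- Multiplication by `i` on `ℂ³ = ℝ⁶`: the Reeb vector field of the Boothby–Wang (standard)
contact form `α₀ = ½ Σ (x dy − y dx)` on `S⁵` is `p ↦ i p` (the Hopf field). -/
def reebSix (p : E6) : E6 :=
  WithLp.toLp 2 ![-(p 1), p 0, -(p 3), p 2, -(p 5), p 4]

/-- The Hopf rotation `p ↦ e^{iθ} p` of `ℂ³`. -/
def hopfRot (θ : ℝ) (p : E6) : E6 :=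
  Real.cos θ • p + Real.sin θ • reebSix p

/-- The standard symplectic form `ω₀ = Σ dx_k ∧ dy_k` of `ℂ³ = ℝ⁶` (`= dα₀`). -/
def omegaSix (u v : E6) : ℝ :=
  (u 0 * v 1 - u 1 * v 0) + (u 2 * v 3 - u 3 * v 2) + (u 4 * v 5 - u 5 * v 4)

/-- **Reeb-fold position** of a smooth map `j : M → S⁵ ⊂ ℂ³` of a 4-manifold: `j` is a smooth
embedding into the unit sphere whose REEB-TANGENCY LOCUS
`T = {x | i·j(x) ∈ dj(T_x M)}` (the fold of the pulled-back form `j^* dα₀`) is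
(i) saturated by Hopf circles, (ii) the image of a connected closed 3-manifold `Z` embedded in
`M` on which `j^*ω₀` has maximal rank 2, and (iii) off `T` every Hopf circle through `j(M)`
meets `j(M)` in exactly two points.  On `S⁴ = S⁵ ∩ {y₃ = 0}` (`j` = inclusion) `T` is the
equator `{z₃ = 0}`, the Hopf circles in `T` are the Hopf fibration of `S³`, and `j^* dα₀` is the
Cannas da Silva–Guillemin–Pires origami form (tree: `sphereOrigamiForm`). -/
def IsReebFoldPosition (M : Type) [TopologicalSpace M] [ChartedSpace E4 M] (j : M → E6) : Prop :=
  Manifold.IsSmoothEmbedding (𝓡 4) 𝓘(ℝ, E6) ∞ j ∧ (∀ x, ‖j x‖ = 1) ∧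
  let T : Set M := {x | reebSix (j x) ∈ Set.range (mfderiv (𝓡 4) 𝓘(ℝ, E6) j x)}
  (∀ x ∈ T, ∀ θ : ℝ, hopfRot θ (j x) ∈ j '' T) ∧
  (∃ (Z : Type) (_ : TopologicalSpace Z) (_ : ChartedSpace (EuclideanSpace ℝ (Fin 3)) Z)
      (_ : IsManifold (𝓡 3) ∞ Z) (z : Z → M),
      Manifold.IsSmoothEmbedding (𝓡 3) (𝓡 4) ∞ z ∧ Set.range z = T ∧ IsConnected T ∧
      ∀ y : Z, ∃ v w : TangentSpace (𝓡 3) y,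
        omegaSix (mfderiv (𝓡 3) 𝓘(ℝ, E6) (j ∘ z) y v) (mfderiv (𝓡 3) 𝓘(ℝ, E6) (j ∘ z) y w) ≠ 0) ∧
  (∀ x, x ∉ T → ∃! θ : ℝ, θ ∈ Set.Ioo (0 : ℝ) (2 * Real.pi) ∧ hopfRot θ (j x) ∈ Set.range j)

/-- **First lemma of idea A (the SW-free, door-free recogniser).**  A smooth homotopy 4-sphere
admitting a Reeb-fold position in the Boothby–Wang sphere `(S⁵, α₀)` is diffeomorphic to `S⁴`.
Paper proof (card §Lever/§Why): saturation makes `T = π_H⁻¹(B)` for a smooth surface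
`B ⊂ ℂℙ²`, the two sides of `T` are sections of the Hopf bundle over `ℂℙ² ∖ B` (clause (iii)),
`χ` and the `H₁`-count force `B ≅ S²` of degree `+1`, max-rank makes `B` `ω_FS`-symplectic, so
`B` is a line (Gromov 1985; tree: `mcduffWendl_plusOneSphere_affinePair` at `N = ℂℙ²`), both
closed sides are `ℂℙ² ∖ ν(line) ≅ B⁴`, and `M = B⁴ ∪ B⁴ ≅ S⁴` by `Γ₄ = 0`
(`cerf_twistedSphere_four`).  No Seiberg–Witten input, no doors. -/
def ReebFoldRecognition : Prop :=
  ∀ (M : Type) [TopologicalSpace M] [T2Space M] [SecondCountableTopology M]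
    [ChartedSpace E4 M] [IsManifold (𝓡 4) ∞ M],
    M ≃ₕ 𝕊⁴ → ∀ j : M → E6, IsReebFoldPosition M j → Nonempty (M ≃ₘ⟮𝓡 4, 𝓡 4⟯ 𝕊⁴)

/-- **E⁺, the strengthened existence statement of idea A**: every smooth homotopy 4-sphere
admits a Reeb-fold position in `(S⁵, α₀)`.  True at `S⁴` (inclusion `{y₃ = 0}`); implies
`OrigamiFoldExistence` (the pulled-back `dα₀` is origami, unfolding = Hopf projection) and,
with `ReebFoldRecognition`, decides SPC4 without `OrigamiRung`/`NoGenusTwoDoor`. Zero slack. -/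
def ReebFoldPositionExists : Prop :=
  ∀ (M : Type) [TopologicalSpace M] [T2Space M] [SecondCountableTopology M]
    [ChartedSpace E4 M] [IsManifold (𝓡 4) ∞ M],
    M ≃ₕ 𝕊⁴ → ∃ j : M → E6, IsReebFoldPosition M j

/-- Composition (sorry-free): E⁺ and the recogniser give the summit statement directly. -/
theorem smoothPoincare4_of_reebFold (hR : ReebFoldRecognition) (hX : ReebFoldPositionExists) :
    _root_.SmoothPoincare4 := by
  unfold _root_.SmoothPoincare4 Literature.SPC4.SmoothPoincareConjectureFour
    ContinuousMap.HomotopyEquiv.NonemptyDiffeomorphSphere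
  intro M _ _ _ _ _ e
  obtain ⟨j, hj⟩ := hX M e
  exact hR M e j hj

/-- Composition (sorry-free): E⁺ and the recogniser give the crux (via the proved zero-slack
transport `Negative.origamiFoldExistence_of_smoothPoincare4` and the proved support item
`RoundSphereIsOrigamiFold`, stmt-7845) — `OrigamiRung` and `NoGenusTwoDoor` are not used. -/
theorem origamiFoldExistence_of_reebFold (hR : ReebFoldRecognition) (hX : ReebFoldPositionExists)
    (hRS : RoundSphereIsOrigamiFold) : OrigamiFoldExistence :=
  Negative.origamiFoldExistence_of_smoothPoincare4 (smoothPoincare4_of_reebFold hR hX) hRS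

/-! ## Idea B — `bennequin-defect-certificates` -/

/-- **First lemma of idea B (the certificate lemma), proved from two named facts.**  Let `W`
be a compact Stein domain (`S : SteinStructure W`, e.g. the Stein 1-handlebody
`♮ᵏ S¹ × B³`) and let `Δ` be `W` with finitely many 2-handles attached along LEGENDRIAN
attaching circles whose handle framings have twisting number `-1` (Akbulut–Matveyev defect
`max{f + 1 - tb, 0} = 0` with equality `f = tb - 1`).  If the boundary of `Δ` is `S³`, then
`Δ ≅ B⁴`.  [Gompf1998 Thm 1.3; AkbulutMatveyev1998 §3; Eliashberg1990 Thm 5.1] -/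
theorem legendrianCertificate_ball (hG : Gompf1998_thm13_twoHandles)
    (hE : Eliashberg1990_steinFilling_sphere_three)
    (W Δ : Type) [TopologicalSpace W] [T2Space W] [ChartedSpace (EuclideanHalfSpace 4) W]
    [IsManifold (𝓡∂ 4) ∞ W] [CompactSpace W] [TopologicalSpace Δ] [T2Space Δ]
    [SecondCountableTopology Δ] [ChartedSpace (EuclideanHalfSpace 4) Δ] [IsManifold (𝓡∂ 4) ∞ Δ]
    [CompactSpace Δ] (S : SteinStructure W) (ι : Type) [Finite ι] (h : ι → HandleAttachingMap 3 2 W)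
    (hΔ : HandleAttachingMap.IsMultiAttachment h (𝓡∂ 4) Δ)
    (hLeg : ∀ i, IsLegendrianKnot S.J (h i).attachingCircle)
    (htw : ∀ i, S.twisting (h i).attachingCircle (h i).attachingFraming = -1)
    (hb : ∃ b : BoundaryData (𝓡∂ 4) Δ (𝓡 3), Nonempty (b.carrier ≃ₘ⟮𝓡 3, 𝓡 3⟯ 𝕊³)) :
    Nonempty (Δ ≃ₘ⟮𝓡∂ 4, 𝓡∂ 4⟯ 𝔻⁴) :=
  hE Δ (hG W Δ S ι h hΔ hLeg htw) hb

/-- **Bennequin defect of a Legendrian presentation** (Akbulut–Matveyev's total defect of the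
2-handles, `Σᵢ max{fᵢ + 1 - tb(Kᵢ), 0}`): zero iff every handle framing is at most `tb − 1`;
after Gompf's left-twist isotopy (`Gompf1998_addLeftTwists`) defect zero is the hypothesis of
`legendrianCertificate_ball`. -/
def bennequinDefect {W : Type} [TopologicalSpace W] [T2Space W] [ChartedSpace (EuclideanHalfSpace 4) W]
    [IsManifold (𝓡∂ 4) ∞ W] [CompactSpace W] (S : SteinStructure W) {ι : Type} [Fintype ι]
    (h : ι → HandleAttachingMap 3 2 W) : ℕ :=
  ∑ i, S.defect (h i).attachingCircle (h i).attachingFraming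

/-- **Apex of the line of idea B (scope: fake balls that are 2-handlebodies = 3-handle-free
homotopy spheres).**  Every compact 4-manifold `Δ` with boundary `S³` that arises from the
standard Stein 1-handlebody by attaching 2-handles and is CONTRACTIBLE admits SOME presentation
(Stein base `W`, Legendrian attaching link, framings) of Bennequin defect zero with twisting
exactly `-1`.  Zero slack inside the scope (⟺ "3-handle-free homotopy 4-spheres are
standard"); the engine is a certificate SEARCH per presentation, the obstruction theory is
`tb`-bounds from rational-ball filling classifications (card). -/
def LegendrianPresentationOfFakeBalls : Prop :=
  ∀ (Δ : Type) [TopologicalSpace Δ] [T2Space Δ] [SecondCountableTopology Δ]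
    [ChartedSpace (EuclideanHalfSpace 4) Δ] [IsManifold (𝓡∂ 4) ∞ Δ] [CompactSpace Δ]
    [ContractibleSpace Δ],
    (∃ b : BoundaryData (𝓡∂ 4) Δ (𝓡 3), Nonempty (b.carrier ≃ₘ⟮𝓡 3, 𝓡 3⟯ 𝕊³)) →
    -- `Δ` is a 2-handlebody: some Stein domain `W₀` plus 2-handles (smoothly; no Legendrian
    -- condition) — this is the "3-handle-free" scope hypothesis
    (∃ (W₀ : Type) (_ : TopologicalSpace W₀) (_ : T2Space W₀) (_ : ChartedSpace (EuclideanHalfSpace 4) W₀)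
        (_ : IsManifold (𝓡∂ 4) ∞ W₀) (_ : CompactSpace W₀) (_ : SteinStructure W₀) (ι₀ : Type)
        (_ : Finite ι₀) (h₀ : ι₀ → HandleAttachingMap 3 2 W₀),
        HandleAttachingMap.IsMultiAttachment h₀ (𝓡∂ 4) Δ) →
    ∃ (W : Type) (_ : TopologicalSpace W) (_ : T2Space W) (_ : ChartedSpace (EuclideanHalfSpace 4) W)
      (_ : IsManifold (𝓡∂ 4) ∞ W) (_ : CompactSpace W) (S : SteinStructure W) (ι : Type)
      (_ : Finite ι) (h : ι → HandleAttachingMap 3 2 W),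
      HandleAttachingMap.IsMultiAttachment h (𝓡∂ 4) Δ ∧
      (∀ i, IsLegendrianKnot S.J (h i).attachingCircle) ∧
      (∀ i, S.twisting (h i).attachingCircle (h i).attachingFraming = -1)

/-- Composition (sorry-free): in the scope, the apex plus the two named facts standardise the
fake ball. -/
theorem fakeBall_ball_of_legendrianPresentation (hG : Gompf1998_thm13_twoHandles)
    (hE : Eliashberg1990_steinFilling_sphere_three) (hL : LegendrianPresentationOfFakeBalls)
    (Δ : Type) [TopologicalSpace Δ] [T2Space Δ] [SecondCountableTopology Δ]
    [ChartedSpace (EuclideanHalfSpace 4) Δ] [IsManifold (𝓡∂ 4) ∞ Δ] [CompactSpace Δ]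
    [ContractibleSpace Δ]
    (hb : ∃ b : BoundaryData (𝓡∂ 4) Δ (𝓡 3), Nonempty (b.carrier ≃ₘ⟮𝓡 3, 𝓡 3⟯ 𝕊³))
    (h2 : ∃ (W₀ : Type) (_ : TopologicalSpace W₀) (_ : T2Space W₀) (_ : ChartedSpace (EuclideanHalfSpace 4) W₀)
        (_ : IsManifold (𝓡∂ 4) ∞ W₀) (_ : CompactSpace W₀) (_ : SteinStructure W₀) (ι₀ : Type)
        (_ : Finite ι₀) (h₀ : ι₀ → HandleAttachingMap 3 2 W₀),
        HandleAttachingMap.IsMultiAttachment h₀ (𝓡∂ 4) Δ) :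
    Nonempty (Δ ≃ₘ⟮𝓡∂ 4, 𝓡∂ 4⟯ 𝔻⁴) := by
  obtain ⟨W, _, _, _, _, _, S, ι, _, h, hΔ, hLeg, htw⟩ := hL Δ hb h2
  exact legendrianCertificate_ball hG hE W Δ S ι h hΔ hLeg htw hb

end Summit.SmoothPoincare4.SmoothPoincare4.Cruxes.OrigamiFoldExistence.Ideator4
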